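import Literature.AnabelianGeometry.SemiGraphs.ProSigmaCuspInertiaMalnormalBasis
import Literature.AnabelianGeometry.SemiGraphs.ProSigmaBoundaryMalnormal
import Literature.AnabelianGeometry.SemiGraphs.SurfaceTypeEstrangedProofs
import Literature.AnabelianGeometry.AbsoluteAnabelian.ProfiniteTerminology
import HarnessLib

/-!
# `ProSigmaCuspInertiaMalnormal` holds; [SemiAnbd] Example 2.10 (4) is unconditional

[SemiAnbd] Example 2.10 (p. 31) / [AbsAnab] Lemma 1.3.7: abc-iut-L3-t11's named fact
`ProSigmaCuspInertiaMalnormal` (`SurfaceTypeEstranged.lean`; the group-theoretic input of "totally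
estranged": in the pro-`Σ` completion of a hyperbolic punctured surface group the closed cusp inertia
subgroups are infinite, pairwise disjoint up to conjugacy, and malnormal)
[cite: MochizukiSemiAnbd2006, Ex. 2.10 p.31] is PROVED by assembling

* abc-iut-L5-t9: clause (A) (`ProSigmaCuspInertia.lean`) and the `r ≥ 3` disjointness
  (`ProSigmaCuspInertiaDisjoint.lean`);
* abc-iut-w5-d016: `r = 2` disjointness, malnormality for `r ≥ 2` and the assembly modulo the
  once-punctured clause (`ProSigmaCuspInertiaMalnormalBasis.lean`, `…DisjointTwo`, `…Malnormal`);
* abc-iut-w5-d051: the once-punctured clause (`ProSigmaBoundaryMalnormal.lean`,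
  `proSigmaCuspInertiaMalnormal_onePunctured`).

Consequence: abc-iut-L3-t11's `example_2_10_totallyEstranged_of` becomes unconditional — every
semi-graph of anabelioids of surface type is totally estranged.  Theorems only; classical profinite group
theory under OUR kernel check; no side is taken on [IUTchIII] Cor. 3.12.
-/

namespace Literature.AnabelianGeometry.SemiGraphs.SemiGraphOfAnabelioids

universe v v₁ u₁ u

/-- **[SemiAnbd] Example 2.10 / [AbsAnab] Lemma 1.3.7 input, PROVED: `ProSigmaCuspInertiaMalnormal`.**
In the pro-`Σ` completion of a hyperbolic punctured surface group the closed cusp inertia subgroups are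
infinite, pairwise disjoint up to conjugacy, and malnormal. [cite: MochizukiSemiAnbd2006, Ex. 2.10 p.31] -/
theorem proSigmaCuspInertiaMalnormal_holds : ProSigmaCuspInertiaMalnormal.{v} :=
  proSigmaCuspInertiaMalnormal_of_onePunctured proSigmaCuspInertiaMalnormal_onePunctured

/-- **[SemiAnbd] Example 2.10, conjunct (4), UNCONDITIONAL**: every semi-graph of anabelioids of surface
type is totally estranged (abc-iut-L3-t11's `example_2_10_totallyEstranged_of` fed with
`proSigmaCuspInertiaMalnormal_holds`). [cite: MochizukiSemiAnbd2006, Ex. 2.10 p.31] -/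
theorem example_2_10_totallyEstranged (𝒢 : SemiGraphOfAnabelioids.{v₁, u₁, u}) (Sigma : Set ℕ)
    (hS : 𝒢.IsOfSurfaceType Sigma) : 𝒢.IsTotallyEstranged :=
  example_2_10_totallyEstranged_of proSigmaCuspInertiaMalnormal_holds.{max u₁ v₁} 𝒢 Sigma hS

/-- The implication between the named facts' shapes, now absolute: surface type ⇒ totally estranged.
[cite: MochizukiSemiAnbd2006, Ex. 2.10 p.31] -/
theorem isTotallyEstranged_of_isOfSurfaceType_holds :
    ∀ (𝒢 : SemiGraphOfAnabelioids.{v₁, u₁, u}) (Sigma : Set ℕ), 𝒢.IsOfSurfaceType Sigma →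
      𝒢.IsTotallyEstranged :=
  fun 𝒢 Sigma hS => example_2_10_totallyEstranged 𝒢 Sigma hS

/-! ### Corollaries: centralisers and commensurable terminality of cusp inertia -/

section Corollaries

open Literature.GroupTheory.CombinatorialGroupTheory
open scoped Pointwise

variable {Sigma : Set ℕ} {g r : ℕ} {P : Type v} [Group P] [TopologicalSpace P] [IsTopologicalGroup P]
  [CompactSpace P] [T2Space P] [TotallyDisconnectedSpace P]

/-- **Centralisers of non-trivial cusp inertia elements**: for a pro-`Σ` completion `ι : Γ_{g,r} → P`
of a hyperbolic type (`Σ` nonempty primes) and `1 ≠ y ∈ I_i = closure ι⟨c_i⟩`, every element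
commuting with `y` lies in `I_i`. [cite: MochizukiSemiAnbd2006, Ex. 2.10 p.31] -/
theorem mem_cuspInertia_closure_of_commute (hne : Sigma.Nonempty) (hprime : ∀ p ∈ Sigma, p.Prime)
    (h : PuncturedSurfaceGroup.IsHyperbolicType g r) (ι : PuncturedSurfaceGroup g r →* P)
    (hι : IsProSigmaCompletion Sigma ι) (i : Fin r) {x y : P}
    (hy : y ∈ ((PuncturedSurfaceGroup.cuspInertia (g := g) i).map ι).topologicalClosure) (hy1 : y ≠ 1)
    (hxy : Commute x y) :
    x ∈ ((PuncturedSurfaceGroup.cuspInertia (g := g) i).map ι).topologicalClosure := by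
  by_contra hx
  have hbot := (proSigmaCuspInertiaMalnormal_holds Sigma hne hprime g r h P ι hι i i).2 x (Or.inr hx)
  have hmem : y ∈ ((PuncturedSurfaceGroup.cuspInertia (g := g) i).map ι).topologicalClosure ⊓
      ConjAct.toConjAct x • ((PuncturedSurfaceGroup.cuspInertia (g := g) i).map ι).topologicalClosure := by
    refine ⟨hy, (Subgroup.mem_smul_pointwise_iff_exists _ _ _).mpr ⟨y, hy, ?_⟩⟩
    rw [ConjAct.toConjAct_smul, hxy.eq, mul_inv_cancel_right]
  rw [hbot, Subgroup.mem_bot] at hmem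
  exact hy1 hmem

/-- **Cusp inertia is commensurably terminal in the vertex group** (the local form of [SemiAnbd]
Remark 2.10.1): `C_P(I_i) = I_i` — an element `x` with `I_i ∩ x I_i x⁻¹` of finite index in the infinite
procyclic `I_i` makes that intersection non-trivial, so `x ∈ I_i` by malnormality.
[cite: MochizukiSemiAnbd2006, Ex. 2.10 p.31] -/
theorem cuspInertia_closure_isCommensurablyTerminal (hne : Sigma.Nonempty)
    (hprime : ∀ p ∈ Sigma, p.Prime) (h : PuncturedSurfaceGroup.IsHyperbolicType g r)
    (ι : PuncturedSurfaceGroup g r →* P) (hι : IsProSigmaCompletion Sigma ι) (i : Fin r) :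
    AbsoluteAnabelian.IsCommensurablyTerminal
      ((PuncturedSurfaceGroup.cuspInertia (g := g) i).map ι).topologicalClosure := by
  set I := ((PuncturedSurfaceGroup.cuspInertia (g := g) i).map ι).topologicalClosure with hI
  have hfact := proSigmaCuspInertiaMalnormal_holds Sigma hne hprime g r h P ι hι i i
  have hle : I ≤ Subgroup.Commensurable.commensurator I := by
    intro k hk
    rw [Subgroup.Commensurable.commensurator_mem_iff]
    have hkI : ConjAct.toConjAct k • I = I := by
      ext z
      rw [Subgroup.mem_smul_pointwise_iff_exists]
      constructor
      · rintro ⟨s, hs, rfl⟩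
        rw [ConjAct.toConjAct_smul]
        exact I.mul_mem (I.mul_mem hk hs) (I.inv_mem hk)
      · intro hz
        refine ⟨k⁻¹ * z * k, I.mul_mem (I.mul_mem (I.inv_mem hk) hz) hk, ?_⟩
        rw [ConjAct.toConjAct_smul]
        group
    rw [hkI]
  refine ⟨le_antisymm (fun x hx => ?_) hle⟩
  by_contra hxI
  have hbot : I ⊓ ConjAct.toConjAct x • I = ⊥ := hfact.2 x (Or.inr hxI)
  -- `x I x⁻¹ ∩ I` has finite index in `I`, an infinite group: so it is non-trivial
  have hcomm : Subgroup.Commensurable (ConjAct.toConjAct x • I) I :=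
    (Subgroup.Commensurable.commensurator_mem_iff I x).mp hx
  haveI hinf : Infinite I := hfact.1
  haveI hfi : ((ConjAct.toConjAct x • I).subgroupOf I).FiniteIndex := ⟨hcomm.1⟩
  have hne1 : ((ConjAct.toConjAct x • I).subgroupOf I) ≠ ⊥ := by
    intro hb
    have hidx := Subgroup.index_bot (G := I)
    rw [← hb] at hidx
    have := ((ConjAct.toConjAct x • I).subgroupOf I).index_ne_zero_of_finite
    rw [hidx] at this
    exact this Nat.card_eq_zero_of_infinite
  apply hne1
  rw [eq_bot_iff]
  intro z hz
  have hz' : (z : P) ∈ I ⊓ ConjAct.toConjAct x • I := ⟨z.2, hz⟩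
  rw [hbot, Subgroup.mem_bot] at hz'
  exact Subgroup.mem_bot.mpr (Subtype.ext hz')

end Corollaries

end Literature.AnabelianGeometry.SemiGraphs.SemiGraphOfAnabelioids
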